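import Summits.BirchSwinnertonDyer.BirchSwinnertonDyer.Theorems.AlignedTransportAtTwoMainConjectureOfRankZeroBSDAtTwoFineRoadCoinvCrux
import HarnessLib

/-!
# Route `AlignedTransportAtTwo`, crux C2 `MainConjectureOfRankZeroBSDAtTwo` (stmt-BirchSwinnertonDyer-22298):
# road (b″) with the ARCHIMEDEAN BALANCE — the descent hypotheses that hold for BOTH signs of `Δ_E`

HONEST FRAMING (cell `bsd-f1-sign2`, lead prover seat `bsd-line-att-p2` gen 2; BSD is NOT proved by any of
this). THEOREMS ONLY; nothing asserted. Correction-in-generality of `…FineRoadCoinvCrux`: there the fine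
comparison `fy : X₀(E/K_∞)_Δ → X₀(E/ℚ_∞)` was asked to have FINITE kernel — true when `Δ_E < 0`
(`H¹(ℝ, E[2^∞]) = 0`), but when `Δ_E > 0` its kernel is dual to the archimedean part
`⊕_{v real} H¹(ℚ_{∞,v}, E[2^∞])` of the relaxed fine Selmer group, a module killed by `2` that may carry
`μ = 1` (Greenberg's strict/relaxed phenomenon at `2`, cell bsd-2adic audit D-AUDIT-h17 row C3). The SAME
`(Λ/2)` sits in the kernel of the Selmer-side descent `fd : X(E/K_∞)_Δ → X(E/ℚ_∞)` (dual of
`Sel^{rel}/Sel^{str}`). So the honest class-wide hypothesis is the ARCHIMEDEAN BALANCE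
`ℓ_{(2)}(ker fy) ≤ ℓ_{(2)}(ker fd)` — void for `Δ_E < 0`, and for `Δ_E > 0` the statement that the real-place
localisation of `Sel^{rel}(E/ℚ_∞)` is as surjective as that of `Sel₀^{rel}` ([Gr] LNM 1716 §4, the surjectivity
lemma behind Thm. 4.1 at `p = 2`; displayed, not proved here).

* `selmerDual_mu_eq_zero_of_roadB2_arch_two` — per datum: Conj A at `(E,2)` over `ℚ`, even-branch `μ₂ = 0`,
  the displayed Kato data over `ℚ(ζ_{2^∞})` with `Δ`-action and finite Coleman cokernel, `X(E/K_∞)` finitely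
  generated torsion (Kato 17.4 (1) over `ℚ(i)`), `fd` with finite cokernel, and the archimedean balance
  ⟹ `μ(X(E/ℚ_∞)) = 0`.
* `seedMuZeroAtTwo_of_fineRoadCoinvArch` / `mainConjectureOfRankZeroBSDAtTwo_of_fineRoadCoinvArch` — stub T and
  C2 BY NAME from PRINT {modularity, Lim 2017 Thm. 3.5 at `2`} + (K₂‴ = K₂″ with the balance) + (A₂). This is
  the version registered as the line's second road.

References: K. Kato, Astérisque 295 (2004), §12.1, Thm. 12.6, (14.9.3), Thm. 16.6, Thm. 17.4 (1), Prop. 17.11,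
§17.13; R. Greenberg, LNM 1716 (1999) §3–§4; M. F. Lim, Asian J. Math. 21 (2017) Thm. 3.5; J. Coates,
R. Sujatha, Math. Ann. 331 (2005) §3.
-/

set_option linter.dupNamespace false
set_option autoImplicit false

noncomputable section

open scoped Classical

open Literature.NumberTheory.EllipticCurves Literature.NumberTheory.EllipticCurves.Module

namespace Summit.BirchSwinnertonDyer.BirchSwinnertonDyer.Theorems.AlignedTransportAtTwoFineRoad

/-! ## §1 Per datum at `2`, with the archimedean balance -/

section AtTwo

open WeierstrassCurve Summit.BirchSwinnertonDyer.Rank1Residual.X1.MuLambda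

/-- In `ℕ∞`: `a + b ≤ a` with `a` finite forces `b = 0`. [folklore] -/
theorem enat_eq_zero_of_add_le_self {a b : ℕ∞} (h : a + b ≤ a) (ha : a ≠ ⊤) : b = 0 := by
  obtain ⟨n, rfl⟩ := ENat.ne_top_iff_exists.mp ha
  induction b using ENat.recTopCoe with
  | top => simp at h
  | coe m =>
    have : (n : ℕ∞) + m ≤ n := h
    norm_cast at this
    have hm : m = 0 := by omega
    simp [hm]

variable (W : WeierstrassCurve ℚ) {κ : ZpExtension ℚ 2} {γ : Field.absoluteGaloisGroup ℚ}

/-- **ROAD (b″) PER CYCLOTOMIC DATUM, BOTH SIGNS OF `Δ_E`.** As `selmerDual_mu_eq_zero_of_roadB2_two`, with the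
fine comparison's finite-kernel hypothesis replaced by the ARCHIMEDEAN BALANCE
`ℓ_{(2)}(ker fy) ≤ ℓ_{(2)}(ker fd)` and with `X' = X(E/K_∞)` finitely generated torsion (Kato 17.4 (1) over
`ℚ(i)`): statement (A) at `(E,2)` over `ℚ` + even-branch `μ₂ = 0` + the displayed data ⟹ `μ(X(E/ℚ_∞)) = 0`.
Proof: `ℓ(X'_Δ) ≤ ℓ(Y'_Δ) ≤ ℓ(ker fy) ≤ ℓ(ker fd) ≤ ℓ(X'_Δ) < ∞` forces `ℓ(X'_Δ/ker fd) = 0`, i.e.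
`ℓ(range fd) = 0`, and the cokernel of `fd` is finite. [cite: Kato2004Asterisque, Thm. 17.4 (1) (p. 273), Prop. 17.11 (p. 277), §17.13 (pp. 279–280)]
[cite: GreenbergLNM1716, §3–§4 (restriction along the cyclotomic tower; the real places at p = 2)]
[cite: CoatesSujatha2005, statement (A) (§3)] -/
theorem selmerDual_mu_eq_zero_of_roadB2_arch_two (hγ : κ.IsTopGenerator γ) (D : W.SelmerDualData κ γ)
    (Yd : W.FineSelmerDualData κ γ) (hA : Set.Finite {s : W.fineSelmerInfty κ | 2 • s = 0})
    {G : IwasawaAlgebra 2} (hred : red G ≠ 0)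
    {P X' Y' : Type*} [AddCommGroup P] [_root_.Module (IwasawaAlgebra 2) P]
    [AddCommGroup X'] [_root_.Module (IwasawaAlgebra 2) X']
    [AddCommGroup Y'] [_root_.Module (IwasawaAlgebra 2) Y']
    (toX : P →ₗ[IwasawaAlgebra 2] X') (π : X' →ₗ[IwasawaAlgebra 2] Y') (hX : Function.Exact toX π)
    (hπ : Function.Surjective π) (cP : P →ₗ[IwasawaAlgebra 2] P) (cX : X' →ₗ[IwasawaAlgebra 2] X')
    (cY : Y' →ₗ[IwasawaAlgebra 2] Y') (hcX : toX ∘ₗ cP = cX ∘ₗ toX) (hcY : π ∘ₗ cX = cY ∘ₗ π)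
    (col : P →ₗ[IwasawaAlgebra 2] IwasawaAlgebra 2 × IwasawaAlgebra 2) (hcol : Function.Injective col)
    (hccol : col ∘ₗ cP = (LinearEquiv.prodComm (IwasawaAlgebra 2) (IwasawaAlgebra 2) (IwasawaAlgebra 2) :
      IwasawaAlgebra 2 × IwasawaAlgebra 2 →ₗ[IwasawaAlgebra 2] IwasawaAlgebra 2 × IwasawaAlgebra 2) ∘ₗ col)
    (hfin : Finite ((IwasawaAlgebra 2 × IwasawaAlgebra 2) ⧸ LinearMap.range col))
    {w₁ w₂ : P} (h₁ : toX w₁ = 0) (h₂ : toX w₂ = 0) {a b s : IwasawaAlgebra 2} (hw₁ : col w₁ = (a, b))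
    (hw₂ : col w₂ = (b, a)) (hs : s ∉ IwasawaAlgebra.augIdealP 2) (hab : a + b = s * G)
    (hXfg : Module.Finite (IwasawaAlgebra 2) X') (hXt : Module.IsTorsion (IwasawaAlgebra 2) X')
    (fd : (X' ⧸ LinearMap.range (cX - 1)) →ₗ[IwasawaAlgebra 2] D.X)
    (hfd : Finite (D.X ⧸ LinearMap.range fd))
    (fy : (Y' ⧸ LinearMap.range (cY - 1)) →ₗ[IwasawaAlgebra 2] Yd.X)
    (harch : lengthAt (IwasawaAlgebra 2) (LinearMap.ker fy)
        ⟨IwasawaAlgebra.augIdealP 2, IwasawaAlgebra.isPrime_augIdealP_holds 2⟩ ≤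
      lengthAt (IwasawaAlgebra 2) (LinearMap.ker fd)
        ⟨IwasawaAlgebra.augIdealP 2, IwasawaAlgebra.isPrime_augIdealP_holds 2⟩) : D.mu = 0 := by
  let 𝔭 : PrimeSpectrum (IwasawaAlgebra 2) :=
    ⟨IwasawaAlgebra.augIdealP 2, IwasawaAlgebra.isPrime_augIdealP_holds 2⟩
  haveI := hfd
  haveI := hfin
  haveI := hXfg
  -- the even branch and the Coleman cokernel die at `(2)`
  have habp : a + b ∉ IwasawaAlgebra.augIdealP 2 :=
    hab ▸ fun h => ((IwasawaAlgebra.isPrime_augIdealP_holds 2).mem_or_mem h).elim hs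
      (not_mem_augIdealP_of_red_ne_zero hred)
  have hc : lengthAt (IwasawaAlgebra 2) ((IwasawaAlgebra 2 × IwasawaAlgebra 2) ⧸ LinearMap.range col) 𝔭
      = 0 := lengthAt_augIdealP_eq_zero_of_finite 2 _ 𝔭 rfl
  have hq : lengthAt (IwasawaAlgebra 2) (IwasawaAlgebra 2 ⧸ Ideal.span {a + b}) 𝔭 = 0 :=
    lengthAt_quotient_eq_zero_of_not_le (by rw [Ideal.span_singleton_le_iff_mem]; exact habp)
  -- `ℓ(X'_Δ) ≤ ℓ(Y'_Δ) ≤ ℓ(ker fy) ≤ ℓ(ker fd)`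
  have hYd : lengthAt (IwasawaAlgebra 2) Yd.X 𝔭 = 0 :=
    lengthAt_fineSelmerDual_eq_zero_of_finite_twoTorsion W hγ Yd hA
  have hY : lengthAt (IwasawaAlgebra 2) (Y' ⧸ LinearMap.range (cY - 1)) 𝔭 ≤
      lengthAt (IwasawaAlgebra 2) (LinearMap.ker fy) 𝔭 := by
    have h := lengthAt_le_ker_add fy 𝔭
    rwa [hYd, add_zero] at h
  have hXΔ : lengthAt (IwasawaAlgebra 2) (X' ⧸ LinearMap.range (cX - 1)) 𝔭 ≤
      lengthAt (IwasawaAlgebra 2) (LinearMap.ker fd) 𝔭 := by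
    have h := lengthAt_coinv_le_of_roadB2 toX π hX hπ cP cX cY hcX hcY col hcol hccol h₁ h₂ hw₁ hw₂ 𝔭
    rw [hc, hq, zero_add, zero_add] at h
    exact h.trans (hY.trans harch)
  -- `ℓ(X'_Δ) = ℓ(ker fd) + ℓ(X'_Δ / ker fd)` is finite, so `ℓ(X'_Δ / ker fd) = 0`
  have hsplit := lengthAt_eq_add_quotient (R := IwasawaAlgebra 2)
    (M := X' ⧸ LinearMap.range (cX - 1)) (LinearMap.ker fd) 𝔭
  have hne : lengthAt (IwasawaAlgebra 2) (X' ⧸ LinearMap.range (cX - 1)) 𝔭 ≠ ⊤ :=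
    ne_top_of_le_ne_top (lengthAt_ne_top_of_isTorsion 2 X' hXt 𝔭 rfl) (lengthAt_quotient_le _ 𝔭)
  have hker_ne : lengthAt (IwasawaAlgebra 2) (LinearMap.ker fd) 𝔭 ≠ ⊤ :=
    ne_top_of_le_ne_top hne (lengthAt_submodule_le _ 𝔭)
  have hquot : lengthAt (IwasawaAlgebra 2) ((X' ⧸ LinearMap.range (cX - 1)) ⧸ LinearMap.ker fd) 𝔭 = 0 :=
    enat_eq_zero_of_add_le_self (hsplit ▸ hXΔ) hker_ne
  -- `range fd ≅ X'_Δ / ker fd`, and the cokernel of `fd` is finite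
  have hrange : lengthAt (IwasawaAlgebra 2) (LinearMap.range fd) 𝔭 = 0 := by
    rw [← lengthAt_eq_of_linearEquiv fd.quotKerEquivRange 𝔭, hquot]
  have hcok : lengthAt (IwasawaAlgebra 2) (D.X ⧸ LinearMap.range fd) 𝔭 = 0 :=
    lengthAt_augIdealP_eq_zero_of_finite 2 _ 𝔭 rfl
  have hX0 : lengthAt (IwasawaAlgebra 2) D.X 𝔭 = 0 := by
    rw [lengthAt_eq_add_quotient (LinearMap.range fd) 𝔭, hrange, hcok, add_zero]
  change muInvariant 2 D.X = 0
  rw [muInvariant_eq_toNat_lengthAt 2 D.X 𝔭 rfl, hX0]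
  rfl

end AtTwo

/-! ## §2 The crux on road (b″) with the archimedean balance (the registered second road of line `birth`) -/

section Crux

open CongruenceSubgroup WeierstrassCurve Literature.NumberTheory.EllipticCurves.ModularForms
  Literature.NumberTheory.EllipticCurves.Greenberg1999
  Literature.NumberTheory.EllipticCurves.Rank1Residual
  Literature.NumberTheory.IwasawaTheory
  Summit.BirchSwinnertonDyer.Rank1Residual Summit.BirchSwinnertonDyer.Rank1Residual.X1.MuLambda
  Summit.BirchSwinnertonDyer.Rank1Residual.X5 Summit.BirchSwinnertonDyer.Rank1Residual.F1Sign2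
  Summit.BirchSwinnertonDyer.BirchSwinnertonDyer.Theorems.Rank1ResidualX1Defs
  Summit.BirchSwinnertonDyer.BirchSwinnertonDyer.Theses.AlignedTransportAtTwo

/-- **Stub T of line `birth` on road (b″) with the archimedean balance (K₂‴)**: modularity + Lim 2017 at `2`
+ the displayed data for every seed-cell curve and datum (Kato's row over `ℚ(ζ_{2^∞})` with `Δ`-action,
injective `Δ`-equivariant Coleman map with finite cokernel, even-branch zeta value `a + b = s·G₊`,
`X(E/K_∞)` f.g. torsion, descent `fd` with finite cokernel, fine comparison `fy`, archimedean balance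
`ℓ(ker fy) ≤ ℓ(ker fd)`) + (A₂) classical `μ = 0` of a `2`-power-index subfield of `ℚ(W[4])` for every seed
⟹ `SeedMuZeroAtTwo`. [cite: Kato2004Asterisque, Thm. 17.4 (1), Prop. 17.11, §17.13 (pp. 273–280)]
[cite: Lim2017FineSelmer, §3 Thm. 3.5 and Lemma 3.2] [cite: GreenbergLNM1716, §3–§4] -/
theorem seedMuZeroAtTwo_of_fineRoadCoinvArch (hmod : nonempty_modularParametrizationData)
    (hLim : Lim2017.thm35_at_two_fineSelmerDual_moduleFinite_of_classicalMuVanishes_of_le_divisionField_four)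
    (hK2 : ∀ (W : WeierstrassCurve ℚ) [W.IsElliptic] [W.IsGloballyMinimal], IsOrdinaryAt W 2 →
      (∀ x : ℚ, ¬ HasRationalTwoTorsionX W x) →
      ∀ (κ : ZpExtension ℚ 2) (γ : Field.absoluteGaloisGroup ℚ), κ.IsCyclotomic →
      κ.IsTopGenerator γ → IsCyclotomicVariable 2 γ →
      ∀ ⦃N : ℕ⦄ [NeZero N] (f : CuspForm (Gamma0 N) 2), IsNewformOf W f →
      ∀ Gp : IwasawaAlgebra 2, iwasawaToPowerSeries 2 Gp = padicLFunction f (unitRoot W 2 : ℚ_[2]) →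
      ∀ (D : W.SelmerDualData κ γ) (Yd : W.FineSelmerDualData κ γ),
        ∃ (P X' Y' : Type) (_ : AddCommGroup P) (_ : _root_.Module (IwasawaAlgebra 2) P)
          (_ : AddCommGroup X') (_ : _root_.Module (IwasawaAlgebra 2) X')
          (_ : AddCommGroup Y') (_ : _root_.Module (IwasawaAlgebra 2) Y')
          (toX : P →ₗ[IwasawaAlgebra 2] X') (π : X' →ₗ[IwasawaAlgebra 2] Y')
          (cP : P →ₗ[IwasawaAlgebra 2] P) (cX : X' →ₗ[IwasawaAlgebra 2] X')
          (cY : Y' →ₗ[IwasawaAlgebra 2] Y')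
          (col : P →ₗ[IwasawaAlgebra 2] IwasawaAlgebra 2 × IwasawaAlgebra 2) (w₁ w₂ : P)
          (a b s : IwasawaAlgebra 2) (fd : (X' ⧸ LinearMap.range (cX - 1)) →ₗ[IwasawaAlgebra 2] D.X)
          (fy : (Y' ⧸ LinearMap.range (cY - 1)) →ₗ[IwasawaAlgebra 2] Yd.X),
          Function.Exact toX π ∧ Function.Surjective π ∧ toX ∘ₗ cP = cX ∘ₗ toX ∧ π ∘ₗ cX = cY ∘ₗ π ∧
          Function.Injective col ∧
          col ∘ₗ cP = (LinearEquiv.prodComm (IwasawaAlgebra 2) (IwasawaAlgebra 2) (IwasawaAlgebra 2) :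
            IwasawaAlgebra 2 × IwasawaAlgebra 2 →ₗ[IwasawaAlgebra 2]
              IwasawaAlgebra 2 × IwasawaAlgebra 2) ∘ₗ col ∧
          Finite ((IwasawaAlgebra 2 × IwasawaAlgebra 2) ⧸ LinearMap.range col) ∧
          toX w₁ = 0 ∧ toX w₂ = 0 ∧ col w₁ = (a, b) ∧ col w₂ = (b, a) ∧
          s ∉ IwasawaAlgebra.augIdealP 2 ∧ a + b = s * Gp ∧
          Module.Finite (IwasawaAlgebra 2) X' ∧ Module.IsTorsion (IwasawaAlgebra 2) X' ∧
          Finite (D.X ⧸ LinearMap.range fd) ∧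
          lengthAt (IwasawaAlgebra 2) (LinearMap.ker fy)
              ⟨IwasawaAlgebra.augIdealP 2, IwasawaAlgebra.isPrime_augIdealP_holds 2⟩ ≤
            lengthAt (IwasawaAlgebra 2) (LinearMap.ker fd)
              ⟨IwasawaAlgebra.augIdealP 2, IwasawaAlgebra.isPrime_augIdealP_holds 2⟩)
    (hA2 : ∀ (W : WeierstrassCurve ℚ) [W.IsElliptic] [W.IsGloballyMinimal], ¬ W.HasCM →
      IsOrdinaryAt W 2 → (∀ x : ℚ, ¬ HasRationalTwoTorsionX W x) → ¬ IsSquare W.Δ →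
      W.analyticRank = 0 → BSDp W 2 →
      ∃ L : IntermediateField ℚ (AlgebraicClosure ℚ), L ≤ W.divisionField 4 ∧
        (∃ k : ℕ, Module.finrank ℚ (W.divisionField 4) = 2 ^ k * Module.finrank ℚ L) ∧
        ∀ κL : ZpExtension L 2, κL.IsCyclotomic → ClassicalMuVanishes κL) :
    ∀ (W : WeierstrassCurve ℚ) [W.IsElliptic] [W.IsGloballyMinimal], ¬ W.HasCM →
      IsOrdinaryAt W 2 → (∀ x : ℚ, ¬ HasRationalTwoTorsionX W x) → ¬ IsSquare W.Δ →
      W.analyticRank = 0 →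
      (∀ ⦃N : ℕ⦄ [NeZero N] (f : CuspForm (Gamma0 N) 2), IsNewformOf W f →
        ∀ G : IwasawaAlgebra 2, IsEvenBranchLiftAtTwo W f G → red G ≠ 0) →
      BSDp W 2 →
      ∀ (κ : ZpExtension ℚ 2) (γ : Field.absoluteGaloisGroup ℚ), κ.IsCyclotomic →
        κ.IsTopGenerator γ → IsCyclotomicVariable 2 γ →
        ∀ D : W.SelmerDualData κ γ, D.IsTorsion → D.mu = 0 := by
  intro W _ _ hcm hord ht hsq hr hμan hbsd κ γ hκ hγ hγ' D _
  have hirr : Irr W 2 := AlignedTransportAtTwoSeed.irr_two_of_forall_not_hasRationalTwoTorsionX W ht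
  haveI : NeZero (W.conductorNorm ℤ) := ⟨(W.conductorNorm_pos_holds).ne'⟩
  obtain ⟨Dm⟩ := hmod W
  obtain ⟨Gp, hGp⟩ := exists_iwasawaToPowerSeries_eq_padicLFunction_two hord Dm.isNewformOf hirr
  have hred : red Gp ≠ 0 := hμan Dm.f Dm.isNewformOf Gp (Or.inl ⟨hord, hGp⟩)
  let Yd : W.FineSelmerDualData κ γ := W.fineSelmerDualData κ hγ
  obtain ⟨P, X', Y', _, _, _, _, _, _, toX, π, cP, cX, cY, col, w₁, w₂, a, b, s, fd, fy, hX, hπ, hcX, hcY,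
    hcol, hccol, hfin, h₁, h₂, hw₁, hw₂, hs, hab, hXfg, hXt, hfd, harch⟩ :=
    hK2 W hord ht κ γ hκ hγ hγ' Dm.f Dm.isNewformOf Gp hGp D Yd
  obtain ⟨L, hL, hidx, hμL⟩ := hA2 W hcm hord ht hsq hr hbsd
  have hA := finite_fineSelmer_twoTorsion_of_classicalMu W hLim L hL hidx hμL κ hκ
  exact selmerDual_mu_eq_zero_of_roadB2_arch_two W hγ D Yd hA hred toX π hX hπ cP cX cY hcX hcY col hcol
    hccol hfin h₁ h₂ hw₁ hw₂ hs hab hXfg hXt fd hfd fy harch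

/-- **C2 BY NAME on road (b″) with the archimedean balance.** PRINT {Kato 17.4 (1)(2) at `2`, Greenberg 4.1,
period unit, modularity, GZK, Lim 2017 Thm. 3.5 at `2`} + (K₂‴) + (A₂) ⟹ `MainConjectureOfRankZeroBSDAtTwo`.
CONDITIONAL: the item stays open ((A₂) = Iwasawa's `μ = 0` for `S₃`-cubics; (K₂‴) awaits typing + audits).
[cite: Kato2004Asterisque, Thm. 17.4 (p. 273) and §17.13 (pp. 279–280)] [cite: Lim2017FineSelmer, §3 Thm. 3.5 and Lemma 3.2]
[cite: GreenbergLNM1716, Thm. 4.1 (p. 102) and Conj. 1.11 (p. 58)] -/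
theorem mainConjectureOfRankZeroBSDAtTwo_of_fineRoadCoinvArch
    (h17 : ∀ (V : WeierstrassCurve ℚ) [V.IsElliptic] [V.IsGloballyMinimal] [NeZero (V.conductorNorm ℤ)]
      (f : CuspForm (Gamma0 (V.conductorNorm ℤ)) 2), kato_divisibility_allPrimes V 2 (f := f))
    (hGr : Greenberg1999.thm41_charValue_rankZero_anyPrime)
    (hper : realPeriodRat_eq_unit_mul_plusPeriod_two) (hmod : nonempty_modularParametrizationData)
    (hGZK : rank_eq_analyticRank_of_analyticRank_le_one)
    (hLim : Lim2017.thm35_at_two_fineSelmerDual_moduleFinite_of_classicalMuVanishes_of_le_divisionField_four)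
    (hK2 : ∀ (W : WeierstrassCurve ℚ) [W.IsElliptic] [W.IsGloballyMinimal], IsOrdinaryAt W 2 →
      (∀ x : ℚ, ¬ HasRationalTwoTorsionX W x) →
      ∀ (κ : ZpExtension ℚ 2) (γ : Field.absoluteGaloisGroup ℚ), κ.IsCyclotomic →
      κ.IsTopGenerator γ → IsCyclotomicVariable 2 γ →
      ∀ ⦃N : ℕ⦄ [NeZero N] (f : CuspForm (Gamma0 N) 2), IsNewformOf W f →
      ∀ Gp : IwasawaAlgebra 2, iwasawaToPowerSeries 2 Gp = padicLFunction f (unitRoot W 2 : ℚ_[2]) →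
      ∀ (D : W.SelmerDualData κ γ) (Yd : W.FineSelmerDualData κ γ),
        ∃ (P X' Y' : Type) (_ : AddCommGroup P) (_ : _root_.Module (IwasawaAlgebra 2) P)
          (_ : AddCommGroup X') (_ : _root_.Module (IwasawaAlgebra 2) X')
          (_ : AddCommGroup Y') (_ : _root_.Module (IwasawaAlgebra 2) Y')
          (toX : P →ₗ[IwasawaAlgebra 2] X') (π : X' →ₗ[IwasawaAlgebra 2] Y')
          (cP : P →ₗ[IwasawaAlgebra 2] P) (cX : X' →ₗ[IwasawaAlgebra 2] X')
          (cY : Y' →ₗ[IwasawaAlgebra 2] Y')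
          (col : P →ₗ[IwasawaAlgebra 2] IwasawaAlgebra 2 × IwasawaAlgebra 2) (w₁ w₂ : P)
          (a b s : IwasawaAlgebra 2) (fd : (X' ⧸ LinearMap.range (cX - 1)) →ₗ[IwasawaAlgebra 2] D.X)
          (fy : (Y' ⧸ LinearMap.range (cY - 1)) →ₗ[IwasawaAlgebra 2] Yd.X),
          Function.Exact toX π ∧ Function.Surjective π ∧ toX ∘ₗ cP = cX ∘ₗ toX ∧ π ∘ₗ cX = cY ∘ₗ π ∧
          Function.Injective col ∧
          col ∘ₗ cP = (LinearEquiv.prodComm (IwasawaAlgebra 2) (IwasawaAlgebra 2) (IwasawaAlgebra 2) :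
            IwasawaAlgebra 2 × IwasawaAlgebra 2 →ₗ[IwasawaAlgebra 2]
              IwasawaAlgebra 2 × IwasawaAlgebra 2) ∘ₗ col ∧
          Finite ((IwasawaAlgebra 2 × IwasawaAlgebra 2) ⧸ LinearMap.range col) ∧
          toX w₁ = 0 ∧ toX w₂ = 0 ∧ col w₁ = (a, b) ∧ col w₂ = (b, a) ∧
          s ∉ IwasawaAlgebra.augIdealP 2 ∧ a + b = s * Gp ∧
          Module.Finite (IwasawaAlgebra 2) X' ∧ Module.IsTorsion (IwasawaAlgebra 2) X' ∧
          Finite (D.X ⧸ LinearMap.range fd) ∧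
          lengthAt (IwasawaAlgebra 2) (LinearMap.ker fy)
              ⟨IwasawaAlgebra.augIdealP 2, IwasawaAlgebra.isPrime_augIdealP_holds 2⟩ ≤
            lengthAt (IwasawaAlgebra 2) (LinearMap.ker fd)
              ⟨IwasawaAlgebra.augIdealP 2, IwasawaAlgebra.isPrime_augIdealP_holds 2⟩)
    (hA2 : ∀ (W : WeierstrassCurve ℚ) [W.IsElliptic] [W.IsGloballyMinimal], ¬ W.HasCM →
      IsOrdinaryAt W 2 → (∀ x : ℚ, ¬ HasRationalTwoTorsionX W x) → ¬ IsSquare W.Δ →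
      W.analyticRank = 0 → BSDp W 2 →
      ∃ L : IntermediateField ℚ (AlgebraicClosure ℚ), L ≤ W.divisionField 4 ∧
        (∃ k : ℕ, Module.finrank ℚ (W.divisionField 4) = 2 ^ k * Module.finrank ℚ L) ∧
        ∀ κL : ZpExtension L 2, κL.IsCyclotomic → ClassicalMuVanishes κL) :
    MainConjectureOfRankZeroBSDAtTwo :=
  AlignedTransportAtTwoSeed.mainConjectureOfRankZeroBSDAtTwo_of_seedMuZero h17 hGr hper hmod hGZK
    (seedMuZeroAtTwo_of_fineRoadCoinvArch hmod hLim hK2 hA2)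

end Crux

end Summit.BirchSwinnertonDyer.BirchSwinnertonDyer.Theorems.AlignedTransportAtTwoFineRoad

end
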